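import Literature.AlgebraicGeometry.Modules.EvaluationDeterminant
import Literature.AlgebraicGeometry.Modules.SheafHomPullbackIso
import Literature.AlgebraicGeometry.Modules.PullbackAffineChart
import Literature.AlgebraicGeometry.Modules.PushforwardBaseChangeHom
import Literature.AlgebraicGeometry.Modules.SheafHomExact
import Literature.AlgebraicGeometry.Motives.GeneratingSectionsOfIso
import HarnessLib

/-!
# The determinant section of an evaluation family: change of frames, non-vanishing locus, base change

Topic `AlgebraicGeometry/Modules`; namespace `Literature.AlgebraicGeometry.Modules`.  THEOREMS ONLY (no definition, no
named fact, no instance, no notation, no `sorry`), over the definitions ★ `Modules/EvaluationDeterminant` (`evalAtSection`,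
`evalMatrix`, `evalDet`, `FrameSystem.evalDet`).  Cell `hodgecm-mathlib` (D-0151), F-DAG F-9 (9b) row (G1) (road Q2 of the
F-9 census, consumer (M1) `ModuliOfAbelianVarieties/SiegelModuliIntrinsicSections`); count-neutral: HC_CM is proved only modulo
the 7 printed citations until rung 0 closes — nothing here bears on a summit statement.

[MumfordFogartyKirwan1994] Ch. 3 §1 (p. 68): «`D_{α₀,…,α_n} = det [X_i^{(α_j)}]` is a section of `L_{α₀} ⊗ ⋯ ⊗ L_{α_n}`» and
«`U_R` is the open subset defined by `D ≠ 0`»; [Hartshorne1977] II Ex. 5.16 (d): the determinant of a morphism of locally free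
sheaves of the same rank.  For a family `ψ_j : E → L_j` (`j < n`) of morphisms from an `𝒪_X`-module with a frame of size `n`
to modules with rank-one frames, the evaluation determinant `det A ∈ Γ(X, V)` of ★ `evalDet` is a SECTION OF A LINE BUNDLE
READ IN FRAMES: this file proves the three facts that make it so and that the (9b) road consumes.

* §1 `evalMatrix_map` / **`evalDet_map`** — compatibility with restriction to a smaller open.
* §2 **`evalDet_mul_prod_transitionDet`** — the TRANSFORMATION LAW under a change of the frame of `E` (`e ⇝ e₂`) and of the
  rank-one frames (`g_j ⇝ g₂_j`): `det A₂ · ∏_j det T(g_j, g₂_j) = det T(e, e₂) · det A` (the matrix in the new frames is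
  `T(e,e₂)ᵀ · A · diag(T(g₂_j, g_j))`; ★ `transition`/`transitionDet`, `transitionDet_eq_of_subsingleton`); hence
  `evalDet_eq_mul` (the solved form with the inverse rank-one units), **`isUnit_evalDet_iff`** and **`basicOpen_evalDet_eq`**: the
  non-vanishing locus `X_{det A}` does not depend on the frames — it is MFK's open `{D ≠ 0}`.
* §3 the same for FRAME SYSTEMS at two points `s`, `t` (★ `FrameSystem.evalDet`, ★ `FrameSystem.cocycle`):
  **`FrameSystem.map_evalDet_eq_mul`** `det A_s|_V = g^F_{ts} · (∏_j g^{G_j}_{st}) · det A_t|_V` — the coefficient family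
  `t ↦ det A_t` IS a ★ `CocycleSections` datum for the cocycle `(g^F)⁻¹ · ∏_j g^{G_j}` (`FrameSystem.basicOpen_evalDet_inf_le`,
  the `locus` clause) — and `transitionDet_trans_finCongr` (enumeration casts do not change `transitionDet`).
* §4 **`evalMatrix_pullback` / `evalDet_pullback` / `basicOpen_evalDet_pullback`** — BASE CHANGE along `h : Y → X`: the
  evaluation matrix of the pulled-back family `h^*ψ_j` in the pulled-back frames ★ `pullbackFrame` is `h♯` of the evaluation
  matrix (★ `basisSection_pullbackFrame`, ★ `pullback_map_app_unitSection`, ★ `coord_pullbackFrame_unitSection`), so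
  `Y_{det A′} = h⁻¹ X_{det A}` («the formation of `U_R` commutes with base change»).
* §5 (ed. 2) BASE CHANGE OF THE SECTIONS — a commutative square `pr ≫ f = f' ≫ h` with sections `x` of `f`, `x'` of `f'`,
  `x' ≫ pr = h ≫ x`, `E = f_*L`, `ψ_j = ev_{x_j}` (★ `evalAtSection`): (E1) **`evalAtSection_app_pushforwardBaseChangeHom_unitSection`**
  `ev_{x'}(β(η_h b)) = θ(η_h(ev_x b))` (`β` = ★ `pushforwardBaseChangeHom`, `θ : h^*x^*L ≅ x'^*pr^*L` spelled out) and its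
  coordinate form (E2); (N1)/(N2) `ev_x` is natural in `L`; (T) **`evalMatrix_baseChange_transport` / `evalDet_baseChange_transport`
  / `basicOpen_evalDet_baseChange_transport`**: for `φ : pr^*L ≅ M` and `β` invertible, the matrix of `ev_{x'_j} : f'_*M → x'_j{}^*M`
  in the frames transported from `(e_U, g_j)` is `h♯` of the matrix of `ev_{x_j}` — `T'_{det A'} = h⁻¹(T_{det A})`.

## References
* [MumfordFogartyKirwan1994] D. Mumford, J. Fogarty, F. Kirwan, *Geometric Invariant Theory*, 3rd ed. (1994), Ch. 3 §1
  Definition 3.3 and Proposition 3.1 (p. 68).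
* [Hartshorne1977] R. Hartshorne, *Algebraic Geometry* (1977), II Ex. 5.16, II §5 (p. 110).
* [Hartshorne1977] III Prop. 9.3 and Remark 9.3.1 (pp. 254–255) (the base-change morphism `u^*f_* → g_*v^*`).
* [StacksProject] The Stacks Project, Tag 02N6 (base change map).
* [GortzWedhorn2020] U. Görtz, T. Wedhorn, *Algebraic Geometry I*, 2nd ed. (2020), Prop. 11.15 and Rem. 11.16 (p. 298).
-/

noncomputable section

open CategoryTheory AlgebraicGeometry Opposite TopologicalSpace Limits

namespace Literature.AlgebraicGeometry.Modules

open Literature.AlgebraicGeometry.Motives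

universe u

/-! ### §1 Restriction -/

section Restrict

variable {X : Scheme.{u}} {E : X.Modules} {n : ℕ} {L : Fin n → X.Modules} (ψ : ∀ j, E ⟶ L j)
  {U V V' : X.Opens} {I : Type u} (e : SheafOfModules.free I ≅ E.over U) (ε : I ≃ Fin n) (k : V ⟶ U)
  {U' : Fin n → X.Opens} {I' : Fin n → Type u} (g : ∀ j, SheafOfModules.free (I' j) ≅ (L j).over (U' j))
  (ι : ∀ j, I' j) (k' : ∀ j, V ⟶ U' j) (l : V' ⟶ V)

/-- **The evaluation matrix is compatible with restriction**: restricting its entries from `V` to `V′ ≤ V` gives the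
evaluation matrix over `V′` (★ `coord_map`, naturality of `ψ_j`). [cite: Hartshorne1977, II Ex. 5.16] -/
theorem evalMatrix_map :
    (evalMatrix ψ e ε k g ι k').map (X.presheaf.map l.op).hom = evalMatrix ψ e ε (l ≫ k) g ι (fun j ↦ l ≫ k' j) := by
  ext a j
  rw [Matrix.map_apply, evalMatrix_apply, evalMatrix_apply]
  change X.presheaf.map l.op _ = _
  rw [← coord_map (g j) (k' j) l, ← Scheme.Modules.Hom.app_map_apply, presheaf_map_map]

/-- **The evaluation determinant is compatible with restriction.** [cite: Hartshorne1977, II Ex. 5.16] -/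
theorem evalDet_map :
    X.presheaf.map l.op (evalDet ψ e ε k g ι k') = evalDet ψ e ε (l ≫ k) g ι (fun j ↦ l ≫ k' j) := by
  rw [evalDet_eq_det, evalDet_eq_det, ← evalMatrix_map ψ e ε k g ι k' l]
  change (X.presheaf.map l.op).hom _ = _
  rw [RingHom.map_det]
  rfl

end Restrict

/-! ### §2 Change of frames: the transformation law and the frame-independence of the non-vanishing locus -/

section Transform

variable {X : Scheme.{u}} {E : X.Modules} {n : ℕ} {L : Fin n → X.Modules} (ψ : ∀ j, E ⟶ L j)
  {U U₂ V : X.Opens} {I I₂ : Type u} [Fintype I]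
  (e : SheafOfModules.free I ≅ E.over U) (e₂ : SheafOfModules.free I₂ ≅ E.over U₂) (ε : I ≃ Fin n)
  (ε₂ : I₂ ≃ Fin n) (k : V ⟶ U) (k₂ : V ⟶ U₂)
  {U' U₂' : Fin n → X.Opens} {I' I₂' : Fin n → Type u} [∀ j, Fintype (I' j)] [∀ j, Subsingleton (I' j)]
  (g : ∀ j, SheafOfModules.free (I' j) ≅ (L j).over (U' j))
  (g₂ : ∀ j, SheafOfModules.free (I₂' j) ≅ (L j).over (U₂' j))
  (ι : ∀ j, I' j) (ι₂ : ∀ j, I₂' j) (η : ∀ j, I' j ≃ Fin 1) (η₂ : ∀ j, I₂' j ≃ Fin 1)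
  (k' : ∀ j, V ⟶ U' j) (k₂' : ∀ j, V ⟶ U₂' j)

/-- A module morphism is `Γ(X, V)`-linear on sections over `V` (finite sums with coefficients). [cite: Hartshorne1977, II §5 (p. 110)] -/
private theorem app_sum_smul {M N : X.Modules} (φ : M ⟶ N) {κ : Type*} (s : Finset κ) (c : κ → Γ(X, V))
    (m : κ → Γ(M, V)) : φ.app V (∑ a ∈ s, c a • m a) = ∑ a ∈ s, c a • φ.app V (m a) := by
  rw [map_sum]
  exact Finset.sum_congr rfl fun a _ ↦ by rw [Scheme.Modules.Hom.app_smul]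

/-- **The evaluation matrix in new frames, entry by entry**: `A₂_{a₂ j} = (∑_a T(e,e₂)_{a a₂} · A_{a j}) · T(g₂_j, g_j)` — expand
the new basis section `b₂_{a₂}` in the frame `e` (★ `map_basisSection_eq_sum_transition`), apply the `Γ(X,V)`-linear `ψ_j`, and
re-express the generator of `g_j` in `g₂_j` (★ `eq_coord_smul_of_subsingleton`). [cite: Hartshorne1977, II Ex. 5.16] -/
theorem evalMatrix_eq_sum_mul (a₂ j : Fin n) :
    evalMatrix ψ e₂ ε₂ k₂ g₂ ι₂ k₂' a₂ j =
      (∑ a, stdTransition e e₂ ε ε₂ k k₂ a a₂ * evalMatrix ψ e ε k g ι k' a j) *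
        transition (g₂ j) (g j) (k₂' j) (k' j) (ι₂ j) (ι j) := by
  simp only [evalMatrix_apply]
  have hexp : E.presheaf.map k₂.op (basisSection e₂ (ε₂.symm a₂)) =
      ∑ a, stdTransition e e₂ ε ε₂ k k₂ a a₂ • E.presheaf.map k.op (basisSection e (ε.symm a)) := by
    rw [map_basisSection_eq_sum_transition e e₂ k k₂ (ε₂.symm a₂), ← Equiv.sum_comp ε.symm]
    rfl
  rw [hexp, app_sum_smul, coord_sum]
  simp only [coord_smul]
  have hcol : ∀ a, coord (g₂ j) (k₂' j) ((ψ j).app V (E.presheaf.map k.op (basisSection e (ε.symm a)))) (ι₂ j) =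
      coord (g j) (k' j) ((ψ j).app V (E.presheaf.map k.op (basisSection e (ε.symm a)))) (ι j) *
        transition (g₂ j) (g j) (k₂' j) (k' j) (ι₂ j) (ι j) := by
    intro a
    conv_lhs => rw [eq_coord_smul_of_subsingleton (g j) (k' j)
      ((ψ j).app V (E.presheaf.map k.op (basisSection e (ε.symm a)))) (ι j)]
    rw [coord_smul, transition_apply]
  simp only [hcol]
  rw [Finset.sum_mul]
  refine Finset.sum_congr rfl fun a _ ↦ ?_
  ring

/-- The evaluation matrix in the new frames is `T(e,e₂)ᵀ · A · diag(T(g₂_j, g_j))`. [cite: Hartshorne1977, II Ex. 5.16] -/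
theorem evalMatrix_eq_transpose_mul_mul_diagonal :
    evalMatrix ψ e₂ ε₂ k₂ g₂ ι₂ k₂' =
      (stdTransition e e₂ ε ε₂ k k₂).transpose * evalMatrix ψ e ε k g ι k' *
        Matrix.diagonal fun j ↦ transition (g₂ j) (g j) (k₂' j) (k' j) (ι₂ j) (ι j) := by
  ext a₂ j
  rw [Matrix.mul_diagonal, Matrix.mul_apply, evalMatrix_eq_sum_mul ψ e e₂ ε ε₂ k k₂ g g₂ ι ι₂ k' k₂' a₂ j]
  rfl

/-- **TRANSFORMATION LAW of the evaluation determinant** under a change of the (enumerated, size-`n`) frame of `E` and of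
the rank-one frames of the `L_j`, over a common open `V`: `det A₂ · ∏_j det T(g_j, g₂_j) = det T(e, e₂) · det A` — the
determinant is a section of the line bundle with transition functions `det T(e,e₂)⁻¹ · ∏_j T(g_j, g₂_j)` (MFK: `D_α` «is a
section of `L_{α₀} ⊗ ⋯ ⊗ L_{α_n}`», the frame of `E` contributing `(det E)⁻¹`).
[cite: MumfordFogartyKirwan1994, Ch. 3 §1 Definition 3.3 (p. 68)] [cite: Hartshorne1977, II Ex. 5.16] -/
theorem evalDet_mul_prod_transitionDet :
    evalDet ψ e₂ ε₂ k₂ g₂ ι₂ k₂' * ∏ j, transitionDet (g j) (g₂ j) (η j) (η₂ j) (k' j) (k₂' j) =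
      transitionDet e e₂ ε ε₂ k k₂ * evalDet ψ e ε k g ι k' := by
  haveI : ∀ j, Subsingleton (I₂' j) := fun j ↦ (η₂ j).injective.subsingleton
  have hτu : ∀ j, transition (g₂ j) (g j) (k₂' j) (k' j) (ι₂ j) (ι j) *
      transitionDet (g j) (g₂ j) (η j) (η₂ j) (k' j) (k₂' j) = 1 := by
    intro j
    rw [← transitionDet_eq_of_subsingleton (g₂ j) (g j) (η₂ j) (η j) (k₂' j) (k' j) (ι₂ j) (ι j)]
    exact transitionDet_mul_symm (g₂ j) (g j) (η₂ j) (η j) (k₂' j) (k' j)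
  have hprod : (∏ j, transition (g₂ j) (g j) (k₂' j) (k' j) (ι₂ j) (ι j)) *
      ∏ j, transitionDet (g j) (g₂ j) (η j) (η₂ j) (k' j) (k₂' j) = 1 := by
    rw [← Finset.prod_mul_distrib]
    exact Finset.prod_eq_one fun j _ ↦ hτu j
  rw [evalDet_eq_det, evalDet_eq_det, evalMatrix_eq_transpose_mul_mul_diagonal ψ e e₂ ε ε₂ k k₂ g g₂ ι ι₂ k' k₂',
    Matrix.det_mul, Matrix.det_mul, Matrix.det_transpose, Matrix.det_diagonal, ← transitionDet_eq e e₂ ε ε₂ k k₂]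
  calc transitionDet e e₂ ε ε₂ k k₂ * (evalMatrix ψ e ε k g ι k').det *
        (∏ j, transition (g₂ j) (g j) (k₂' j) (k' j) (ι₂ j) (ι j)) *
        ∏ j, transitionDet (g j) (g₂ j) (η j) (η₂ j) (k' j) (k₂' j)
      = transitionDet e e₂ ε ε₂ k k₂ * (evalMatrix ψ e ε k g ι k').det *
          ((∏ j, transition (g₂ j) (g j) (k₂' j) (k' j) (ι₂ j) (ι j)) *
            ∏ j, transitionDet (g j) (g₂ j) (η j) (η₂ j) (k' j) (k₂' j)) := by ring
    _ = transitionDet e e₂ ε ε₂ k k₂ * (evalMatrix ψ e ε k g ι k').det := by rw [hprod, mul_one]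

/-- **Solved form**: `det A₂ = det T(e, e₂) · (∏_j det T(g₂_j, g_j)) · det A`.
[cite: MumfordFogartyKirwan1994, Ch. 3 §1 Definition 3.3 (p. 68)] [cite: Hartshorne1977, II Ex. 5.16] -/
theorem evalDet_eq_mul :
    evalDet ψ e₂ ε₂ k₂ g₂ ι₂ k₂' =
      transitionDet e e₂ ε ε₂ k k₂ * (∏ j, transitionDet (g₂ j) (g j) (η₂ j) (η j) (k₂' j) (k' j)) *
        evalDet ψ e ε k g ι k' := by
  have h := evalDet_mul_prod_transitionDet ψ e e₂ ε ε₂ k k₂ g g₂ ι ι₂ η η₂ k' k₂'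
  have hinv : (∏ j, transitionDet (g j) (g₂ j) (η j) (η₂ j) (k' j) (k₂' j)) *
      ∏ j, transitionDet (g₂ j) (g j) (η₂ j) (η j) (k₂' j) (k' j) = 1 := by
    rw [← Finset.prod_mul_distrib]
    exact Finset.prod_eq_one fun j _ ↦ transitionDet_mul_symm (g j) (g₂ j) (η j) (η₂ j) (k' j) (k₂' j)
  calc evalDet ψ e₂ ε₂ k₂ g₂ ι₂ k₂'
      = evalDet ψ e₂ ε₂ k₂ g₂ ι₂ k₂' * ((∏ j, transitionDet (g j) (g₂ j) (η j) (η₂ j) (k' j) (k₂' j)) *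
          ∏ j, transitionDet (g₂ j) (g j) (η₂ j) (η j) (k₂' j) (k' j)) := by rw [hinv, mul_one]
    _ = (evalDet ψ e₂ ε₂ k₂ g₂ ι₂ k₂' * ∏ j, transitionDet (g j) (g₂ j) (η j) (η₂ j) (k' j) (k₂' j)) *
          ∏ j, transitionDet (g₂ j) (g j) (η₂ j) (η j) (k₂' j) (k' j) := by ring
    _ = _ := by rw [h]; ring

include η η₂ in
/-- **The invertibility of the evaluation determinant does not depend on the frames.**
[cite: MumfordFogartyKirwan1994, Ch. 3 §1 Definition 3.3 (p. 68)] -/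
theorem isUnit_evalDet_iff :
    IsUnit (evalDet ψ e₂ ε₂ k₂ g₂ ι₂ k₂') ↔ IsUnit (evalDet ψ e ε k g ι k') := by
  rw [evalDet_eq_mul ψ e e₂ ε ε₂ k k₂ g g₂ ι ι₂ η η₂ k' k₂', IsUnit.mul_iff, IsUnit.mul_iff]
  have h1 : IsUnit (transitionDet e e₂ ε ε₂ k k₂) := isUnit_transitionDet e e₂ ε ε₂ k k₂
  have h2 : IsUnit (∏ j, transitionDet (g₂ j) (g j) (η₂ j) (η j) (k₂' j) (k' j)) :=
    IsUnit.prod_univ_iff.mpr fun j ↦ isUnit_transitionDet (g₂ j) (g j) (η₂ j) (η j) (k₂' j) (k' j)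
  exact ⟨fun h ↦ h.2, fun h ↦ ⟨⟨h1, h2⟩, h⟩⟩

include η η₂ in
/-- **THE NON-VANISHING LOCUS `X_{det A}` DOES NOT DEPEND ON THE FRAMES** — it is MFK's open set `{D_α ≠ 0}` of the
points (`U_R` is «a property of the points, not of the chosen homogeneous coordinates»).
[cite: MumfordFogartyKirwan1994, Ch. 3 §1 Definition 3.3 (p. 68)] -/
theorem basicOpen_evalDet_eq :
    X.basicOpen (evalDet ψ e₂ ε₂ k₂ g₂ ι₂ k₂') = X.basicOpen (evalDet ψ e ε k g ι k') := by
  rw [evalDet_eq_mul ψ e e₂ ε ε₂ k k₂ g g₂ ι ι₂ η η₂ k' k₂', Scheme.basicOpen_mul, Scheme.basicOpen_mul,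
    X.basicOpen_of_isUnit (isUnit_transitionDet e e₂ ε ε₂ k k₂),
    X.basicOpen_of_isUnit (IsUnit.prod_univ_iff.mpr fun j ↦
      isUnit_transitionDet (g₂ j) (g j) (η₂ j) (η j) (k₂' j) (k' j))]
  exact inf_eq_right.mpr (le_inf (X.basicOpen_le _) (X.basicOpen_le _))

end Transform

/-! ### §3 Frame systems: the coefficient family `t ↦ det A_t` is a section in the `CocycleSections` currency -/

section Enum

variable {X : Scheme.{u}} {E : X.Modules} {W W' V : X.Opens} {I I' : Type u} [Fintype I] [Fintype I']
  (e : SheafOfModules.free I ≅ E.over W) (e' : SheafOfModules.free I' ≅ E.over W') {m m' n : ℕ}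
  (ε : I ≃ Fin m) (ε' : I' ≃ Fin m') (h : m = n) (h' : m' = n) (k : V ⟶ W) (k' : V ⟶ W')

omit [Fintype I] [Fintype I'] in
/-- **Enumeration casts do not change `transitionDet`**: composing both enumerations with `finCongr` casts gives the
same determinant (the matrix is reindexed by the order-preserving `Fin.cast`). [cite: Hartshorne1977, II Ex. 5.16] -/
theorem transitionDet_trans_finCongr :
    transitionDet e e' (ε.trans (finCongr h)) (ε'.trans (finCongr h')) k k' = transitionDet e e' ε ε' k k' := by
  subst h h'
  rw [transitionDet_eq, transitionDet_eq]
  congr 1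

end Enum

namespace FrameSystem

variable {X : Scheme.{u}} {E : X.Modules} {n : ℕ} {L : Fin n → X.Modules} (ψ : ∀ j, E ⟶ L j)
  (F : FrameSystem E) (hF : ∀ t, F.rank t = n) (G : ∀ j, FrameSystem (L j)) (hG : ∀ j t, (G j).rank t = 1)
  (W : X → X.Opens) (hW : ∀ t, W t ≤ F.U t) (hW' : ∀ j t, W t ≤ (G j).U t)

/-- **Restriction**: the determinant at `t` restricted to `V ≤ W t` is the frame-level ★ `evalDet` over `V`.
[cite: Hartshorne1977, II Ex. 5.16] -/
theorem map_evalDet {t : X} {V : X.Opens} (l : V ⟶ W t) :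
    X.presheaf.map l.op (evalDet ψ F hF G hG W hW hW' t) =
      Modules.evalDet ψ (F.frame t) ((F.enum t).trans (finCongr (hF t))) (l ≫ homOfLE (hW t))
        (fun j ↦ (G j).frame t) (fun j ↦ (G j).idx (hG j) t) (fun j ↦ l ≫ homOfLE (hW' j t)) := by
  rw [evalDet_eq]
  exact evalDet_map ψ _ _ _ _ _ _ l

/-- **THE COEFFICIENT FAMILY `t ↦ det A_t` TRANSFORMS BY THE COCYCLE `(g^F)⁻¹ · ∏_j g^{G_j}`**: on an open `V` below `W s`
and `W t`, `det A_s|_V = g^F_{ts} · (∏_j g^{G_j}_{st}) · det A_t|_V`, where `g^F = det T` is the determinant cocycle of the frame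
system `F` of `E` (★ `FrameSystem.cocycle`) and `g^{G_j}` that of the rank-one frame system of `L_j` (the transition function
itself, ★ `transitionDet_eq_of_subsingleton`) — §2 at the frames of the two points.  This is the `c_b = g_{ab} · c_a` input of
★ `CocycleSections.ofCocycle` for MFK's `D_α` as a section of `(det E)⁻¹ ⊗ ⨂_j L_j`.
[cite: MumfordFogartyKirwan1994, Ch. 3 §1 Definition 3.3 (p. 68)] [cite: Hartshorne1977, II Ex. 5.16] -/
theorem map_evalDet_eq_mul {s t : X} {V : X.Opens} (ls : V ≤ W s) (lt : V ≤ W t) :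
    X.presheaf.map (homOfLE ls).op (evalDet ψ F hF G hG W hW hW' s) =
      F.cocycle.g t s V (lt.trans (hW t)) (ls.trans (hW s)) *
        (∏ j, (G j).cocycle.g s t V (ls.trans (hW' j s)) (lt.trans (hW' j t))) *
          X.presheaf.map (homOfLE lt).op (evalDet ψ F hF G hG W hW hW' t) := by
  haveI : Fintype (F.I t) := Fintype.ofEquiv _ (F.enum t).symm
  haveI : Fintype (F.I s) := Fintype.ofEquiv _ (F.enum s).symm
  haveI : ∀ j, Fintype ((G j).I t) := fun j ↦ Fintype.ofEquiv _ ((G j).enum t).symm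
  haveI : ∀ j, Subsingleton ((G j).I t) := fun j ↦ (G j).subsingleton_index (hG j) t
  rw [map_evalDet, map_evalDet,
    evalDet_eq_mul ψ (F.frame t) (F.frame s) ((F.enum t).trans (finCongr (hF t))) ((F.enum s).trans (finCongr (hF s)))
      (homOfLE lt ≫ homOfLE (hW t)) (homOfLE ls ≫ homOfLE (hW s)) (fun j ↦ (G j).frame t) (fun j ↦ (G j).frame s)
      (fun j ↦ (G j).idx (hG j) t) (fun j ↦ (G j).idx (hG j) s)
      (fun j ↦ ((G j).enum t).trans (finCongr (hG j t))) (fun j ↦ ((G j).enum s).trans (finCongr (hG j s)))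
      (fun j ↦ homOfLE lt ≫ homOfLE (hW' j t)) (fun j ↦ homOfLE ls ≫ homOfLE (hW' j s))]
  congr 1
  congr 1
  · rw [transitionDet_trans_finCongr, FrameSystem.cocycle_g]
    exact transitionDet_congr_hom _ _ _ _ _ _ _ _
  · refine Finset.prod_congr rfl fun j _ ↦ ?_
    rw [transitionDet_trans_finCongr, FrameSystem.cocycle_g]
    exact transitionDet_congr_hom _ _ _ _ _ _ _ _

/-- **Locus compatibility** (the `locus` clause of ★ `CocycleSections`): `X_{det A_t} ∩ W s ⊆ X_{det A_s}`.
[cite: MumfordFogartyKirwan1994, Ch. 3 §1 Definition 3.3 (p. 68)] -/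
theorem basicOpen_evalDet_inf_le (s t : X) :
    X.basicOpen (evalDet ψ F hF G hG W hW hW' t) ⊓ W s ≤ X.basicOpen (evalDet ψ F hF G hG W hW hW' s) := by
  have hV : W s ⊓ W t ≤ W s := inf_le_left
  have hV' : W s ⊓ W t ≤ W t := inf_le_right
  have key := map_evalDet_eq_mul ψ F hF G hG W hW hW' (s := s) (t := t) hV hV'
  have hres_s : X.basicOpen (X.presheaf.map (homOfLE hV).op (evalDet ψ F hF G hG W hW hW' s)) =
      X.basicOpen (evalDet ψ F hF G hG W hW hW' s) ⊓ (W s ⊓ W t) := by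
    rw [Scheme.basicOpen_res]; exact inf_comm _ _
  have hres_t : X.basicOpen (X.presheaf.map (homOfLE hV').op (evalDet ψ F hF G hG W hW hW' t)) =
      X.basicOpen (evalDet ψ F hF G hG W hW hW' t) ⊓ (W s ⊓ W t) := by
    rw [Scheme.basicOpen_res]; exact inf_comm _ _
  have hu : IsUnit (F.cocycle.g t s (W s ⊓ W t) (hV'.trans (hW t)) (hV.trans (hW s)) *
      ∏ j, (G j).cocycle.g s t (W s ⊓ W t) (hV.trans (hW' j s)) (hV'.trans (hW' j t))) :=
    (F.cocycle.isUnit_g _ _ _ _ _).mul (IsUnit.prod_univ_iff.mpr fun j ↦ (G j).cocycle.isUnit_g _ _ _ _ _)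
  have heq : X.basicOpen (evalDet ψ F hF G hG W hW hW' s) ⊓ (W s ⊓ W t) =
      X.basicOpen (evalDet ψ F hF G hG W hW hW' t) ⊓ (W s ⊓ W t) := by
    rw [← hres_s, ← hres_t, key, Scheme.basicOpen_mul, X.basicOpen_of_isUnit hu]
    exact inf_eq_right.mpr (X.basicOpen_le _)
  calc X.basicOpen (evalDet ψ F hF G hG W hW hW' t) ⊓ W s
      ≤ X.basicOpen (evalDet ψ F hF G hG W hW hW' t) ⊓ (W s ⊓ W t) :=
        le_inf inf_le_left (le_inf inf_le_right (inf_le_left.trans ((X.basicOpen_le _).trans le_rfl)))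
    _ = X.basicOpen (evalDet ψ F hF G hG W hW hW' s) ⊓ (W s ⊓ W t) := heq.symm
    _ ≤ X.basicOpen (evalDet ψ F hF G hG W hW hW' s) := inf_le_left

end FrameSystem

/-! ### §4 Base change -/

section BaseChange

variable {X Y : Scheme.{u}} (h : Y ⟶ X) {E : X.Modules} {n : ℕ} {L : Fin n → X.Modules} (ψ : ∀ j, E ⟶ L j)
  {U V : X.Opens} {I : Type u} [Fintype I] (e : SheafOfModules.free I ≅ E.over U) (ε : I ≃ Fin n) (k : V ⟶ U)
  {U' : Fin n → X.Opens} {I' : Fin n → Type u} [∀ j, Fintype (I' j)]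
  (g : ∀ j, SheafOfModules.free (I' j) ≅ (L j).over (U' j)) (ι : ∀ j, I' j) (k' : ∀ j, V ⟶ U' j)

/-- **BASE CHANGE of the evaluation matrix**: the evaluation matrix of the pulled-back family `h^*ψ_j : h^*E → h^*L_j` in
the pulled-back frames `η_h(e)`, `η_h(g_j)` (★ `pullbackFrame`) over `h⁻¹V` is `h♯` of the evaluation matrix — the basis
sections pull back (★ `basisSection_pullbackFrame`), `h^*ψ_j(η(b)) = η(ψ_j(b))` (★ `pullback_map_app_unitSection`), and
coordinates of pulled-back sections in pulled-back frames are pulled-back coordinates (★ `coord_pullbackFrame_unitSection`).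
[cite: Hartshorne1977, II §5 (p. 110)] [cite: MumfordFogartyKirwan1994, Ch. 3 §1 Proposition 3.1 (p. 68)] -/
theorem evalMatrix_pullback :
    evalMatrix (fun j ↦ (Scheme.Modules.pullback h).map (ψ j)) (pullbackFrame h e) ε ((Opens.map h.base).map k)
        (fun j ↦ pullbackFrame h (g j)) ι (fun j ↦ (Opens.map h.base).map (k' j)) =
      (evalMatrix ψ e ε k g ι k').map (h.app V).hom := by
  ext a j
  rw [Matrix.map_apply, evalMatrix_apply, evalMatrix_apply, basisSection_pullbackFrame, ← unitSection_map,
    pullback_map_app_unitSection, coord_pullbackFrame_unitSection]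

/-- **BASE CHANGE of the evaluation determinant**: `det A′ = h♯(det A)`. [cite: Hartshorne1977, II §5 (p. 110)]
[cite: MumfordFogartyKirwan1994, Ch. 3 §1 Proposition 3.1 (p. 68)] -/
theorem evalDet_pullback :
    evalDet (fun j ↦ (Scheme.Modules.pullback h).map (ψ j)) (pullbackFrame h e) ε ((Opens.map h.base).map k)
        (fun j ↦ pullbackFrame h (g j)) ι (fun j ↦ (Opens.map h.base).map (k' j)) =
      h.app V (evalDet ψ e ε k g ι k') := by
  rw [evalDet_eq_det, evalDet_eq_det, evalMatrix_pullback]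
  change _ = (h.app V).hom _
  rw [RingHom.map_det]
  rfl

/-- **The non-vanishing locus commutes with base change**: `Y_{det A′} = h⁻¹(X_{det A})` («the formation of `U_R` commutes
with base change»). [cite: MumfordFogartyKirwan1994, Ch. 3 §1 Proposition 3.1 (p. 68)] -/
theorem basicOpen_evalDet_pullback :
    Y.basicOpen (evalDet (fun j ↦ (Scheme.Modules.pullback h).map (ψ j)) (pullbackFrame h e) ε
        ((Opens.map h.base).map k) (fun j ↦ pullbackFrame h (g j)) ι (fun j ↦ (Opens.map h.base).map (k' j))) =
      h ⁻¹ᵁ X.basicOpen (evalDet ψ e ε k g ι k') := by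
  rw [evalDet_pullback, Scheme.preimage_basicOpen]

end BaseChange

end Literature.AlgebraicGeometry.Modules

end

/-! ### §5 (ed. 2) Base change of the sections along a square, naturality in the module, transported frames

SETTING ([Hartshorne1977] III 9.3.1; [StacksProject, Tag 02N6]): a commutative square `pr ≫ f = f' ≫ h` (`f : X → T`, `h : T' → T`,
`pr : X' → X`, `f' : X' → T'`; only commutativity is used), sections `x` of `f`, `x'` of `f'` with `x' ≫ pr = h ≫ x`, an `𝒪_X`-module
`L`; `ev_x : f_*L → x^*L` (★ `evalAtSection`), `β : h^*f_*L → f'_*pr^*L` (★ `pushforwardBaseChangeHom`) read on pulled-back sections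
`η_h(b)`, and `θ : h^*x^*L ≅ x'^*pr^*L` (`pullbackComp`, `pullbackCongr`, `pullbackComp⁻¹` — the first three legs of
★ `pushforwardBaseChangeCounit`) SPELLED OUT with a type ascription (no definition is introduced).  (E1′)/(E1)
`ev_{x'}(β(η_h b)) = θ(η_h(ev_x b))`; (E2) its coordinate form in the frame `η_h(g) ≫ θ|` (★ `pullbackFrame`); (N1)/(N2) naturality of
`ev_x` in `L` (and in coordinates along `φ : L₁ ≅ L₂`); (T) for `φ : pr^*L ≅ M` and `β` an isomorphism, the §2-matrix of
`ev_{x'_j} : f'_*M → x'_j{}^*M` in the frames `η_h(e_U)| ≫ (β ≫ f'_*φ)|`, `η_h(g_j) ≫ (θ_j ≫ x'_j{}^*φ)|` is `h♯` of the matrix of `ev_{x_j}` in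
`(e_U, g_j)`: `det A' = h♯(det A)`, `T'_{det A'} = h⁻¹(T_{det A})`.
-/

noncomputable section

-- `TopCat.Presheaf`/`Scheme.Modules` are not reducible (as in Mathlib's `AlgebraicGeometry/Modules/Sheaf.lean`).
set_option backward.isDefEq.respectTransparency false

open CategoryTheory CategoryTheory.Limits AlgebraicGeometry TopologicalSpace Opposite

namespace Literature.AlgebraicGeometry.Modules

open Literature.AlgebraicGeometry.Motives

universe u

section SquareBaseChange

variable {X T X' T' : Scheme.{u}} {f : X ⟶ T} {h : T' ⟶ T} {pr : X' ⟶ X} {f' : X' ⟶ T'} (w : pr ≫ f = f' ≫ h)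
  (x : T ⟶ X) (hx : x ≫ f = 𝟙 T) (x' : T' ⟶ X') (hx' : x' ≫ f' = 𝟙 T') (hxx' : x' ≫ pr = h ≫ x) (L : X.Modules)

include w hx' in
/-- `h⁻¹V = x'⁻¹pr⁻¹f⁻¹V` (as `x' ≫ pr ≫ f = x' ≫ f' ≫ h = h`). [cite: Hartshorne1977, III Prop. 9.3 (Remark 9.3.1)] -/
theorem preimage_eq_preimage_preimage_preimage_of_section (V : T.Opens) :
    h ⁻¹ᵁ V = x' ⁻¹ᵁ (pr ⁻¹ᵁ (f ⁻¹ᵁ V)) := by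
  have hc : (x' ≫ pr) ≫ f = h := by rw [Category.assoc, w, ← Category.assoc, hx', Category.id_comp]
  rw [← Scheme.Hom.comp_preimage, ← Scheme.Hom.comp_preimage, hc]

/-- **(E1′, base-change side)** `ev_{x'}(β(η_h(b))) = η_{x'}(η_{pr}(b))` transported along `h⁻¹V = x'⁻¹pr⁻¹f⁻¹V` (★ `pushforwardBaseChangeHom_app_unitSection`
«`β(η_h b) = η_{pr} b`», ★ `evalAtSection_app`, ★ `unitSection_map`). [cite: Hartshorne1977, II §5 (p. 110)] [cite: StacksProject, Tag 02N6] -/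
theorem evalAtSection_app_pushforwardBaseChangeHom_unitSection_eq (V : T.Opens) (b : Γ((Scheme.Modules.pushforward f).obj L, V)) :
    (evalAtSection f' x' hx' ((Scheme.Modules.pullback pr).obj L)).app (h ⁻¹ᵁ V)
        ((pushforwardBaseChangeHom w L).app (h ⁻¹ᵁ V)
          (unitSection h ((Scheme.Modules.pushforward f).obj L) V b)) =
      ((Scheme.Modules.pullback x').obj ((Scheme.Modules.pullback pr).obj L)).presheaf.map
        (eqToHom (preimage_eq_preimage_preimage_preimage_of_section w x' hx' V)).op
        (unitSection x' ((Scheme.Modules.pullback pr).obj L) (pr ⁻¹ᵁ (f ⁻¹ᵁ V))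
          (unitSection pr L (f ⁻¹ᵁ V) (show Γ(L, f ⁻¹ᵁ V) from b))) := by
  rw [pushforwardBaseChangeHom_app_unitSection w L V]
  erw [evalAtSection_app f' x' hx' ((Scheme.Modules.pullback pr).obj L) (h ⁻¹ᵁ V)]
  rw [unitSection_map, presheaf_map_map]
  exact presheaf_map_congr _ _ _ _

/-- **(E1′, evaluation side)** `θ(η_h(ev_x(b))) = η_{x'}(η_{pr}(b))` transported along `h⁻¹V = x'⁻¹pr⁻¹f⁻¹V` (`θ = pullbackComp ≫ pullbackCongr ≫
pullbackComp⁻¹`; `η_h η_x ↦ η_{h ≫ x} ↦ η_{x' ≫ pr} ↦ η_{x'} η_{pr}`). [cite: Hartshorne1977, II §5 (p. 110)] [cite: StacksProject, Tag 02N6] -/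
theorem pullbackComp_pullbackCongr_pullbackComp_app_unitSection_eq (V : T.Opens) (b : Γ((Scheme.Modules.pushforward f).obj L, V)) :
    (((Scheme.Modules.pullbackComp h x).app L ≪≫ (Scheme.Modules.pullbackCongr hxx'.symm).app L ≪≫
            ((Scheme.Modules.pullbackComp x' pr).app L).symm :
          (Scheme.Modules.pullback h).obj ((Scheme.Modules.pullback x).obj L) ≅
            (Scheme.Modules.pullback x').obj ((Scheme.Modules.pullback pr).obj L)).hom.app (h ⁻¹ᵁ V))
        (unitSection h ((Scheme.Modules.pullback x).obj L) V ((evalAtSection f x hx L).app V b)) =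
      ((Scheme.Modules.pullback x').obj ((Scheme.Modules.pullback pr).obj L)).presheaf.map
        (eqToHom (preimage_eq_preimage_preimage_preimage_of_section w x' hx' V)).op
        (unitSection x' ((Scheme.Modules.pullback pr).obj L) (pr ⁻¹ᵁ (f ⁻¹ᵁ V))
          (unitSection pr L (f ⁻¹ᵁ V) (show Γ(L, f ⁻¹ᵁ V) from b))) := by
  erw [evalAtSection_app f x hx L V b]
  rw [unitSection_map, app_presheaf_map]
  simp only [Iso.trans_hom, Iso.app_hom, Iso.symm_hom, Iso.app_inv, Scheme.Modules.Hom.comp_app, CategoryTheory.comp_apply]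
  have h1 := pullbackComp_hom_app_unitSection x L h (f ⁻¹ᵁ V) b
  have h2 := pullbackCongr_hom_app_unitSection (M := L) hxx'.symm (f ⁻¹ᵁ V) b
  have h3 := pullbackComp_inv_app_unitSection pr L x' (f ⁻¹ᵁ V) b
  erw [h1, h2, app_presheaf_map, h3, presheaf_map_map]
  exact presheaf_map_congr _ _ _ _

/-- **(E1) EVALUATION AT A SECTION COMMUTES WITH BASE CHANGE** ([Hartshorne1977] III 9.3.1 read at a section): for `b ∈ Γ(f_*L, V)`,
`ev_{x'}(β(η_h b)) = θ(η_h(ev_x b))` as sections of `x'^*pr^*L` over `h⁻¹V` (`β = pushforwardBaseChangeHom`,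
`θ = pullbackComp ≫ pullbackCongr ≫ pullbackComp⁻¹ : h^*x^*L ≅ x'^*pr^*L`). [cite: Hartshorne1977, III Prop. 9.3 (Remark 9.3.1)] [cite: StacksProject, Tag 02N6] -/
theorem evalAtSection_app_pushforwardBaseChangeHom_unitSection (V : T.Opens) (b : Γ((Scheme.Modules.pushforward f).obj L, V)) :
    (evalAtSection f' x' hx' ((Scheme.Modules.pullback pr).obj L)).app (h ⁻¹ᵁ V)
        ((pushforwardBaseChangeHom w L).app (h ⁻¹ᵁ V)
          (unitSection h ((Scheme.Modules.pushforward f).obj L) V b)) =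
      (((Scheme.Modules.pullbackComp h x).app L ≪≫ (Scheme.Modules.pullbackCongr hxx'.symm).app L ≪≫
            ((Scheme.Modules.pullbackComp x' pr).app L).symm :
          (Scheme.Modules.pullback h).obj ((Scheme.Modules.pullback x).obj L) ≅
            (Scheme.Modules.pullback x').obj ((Scheme.Modules.pullback pr).obj L)).hom.app (h ⁻¹ᵁ V))
        (unitSection h ((Scheme.Modules.pullback x).obj L) V ((evalAtSection f x hx L).app V b)) := by
  rw [evalAtSection_app_pushforwardBaseChangeHom_unitSection_eq w x' hx' L V b,
    pullbackComp_pullbackCongr_pullbackComp_app_unitSection_eq w x hx x' hx' hxx' L V b]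

/-- `θ⁻¹|_W (θ(y)|) = y|`: reading a section through a frame transported along `θ` undoes `θ`. [folklore] -/
private theorem appLE_mapIso_inv_app {Y : Scheme.{u}} {M N : Y.Modules} (θ : M ≅ N) {W V : Y.Opens} (k : V ⟶ W) (y : Γ(M, V)) :
    appLE ((SheafOfModules.overFunctor _ W).mapIso θ).inv k (θ.hom.app V y) = y := by
  rw [Functor.mapIso_inv, appLE_over_map, ← CategoryTheory.comp_apply, ← Scheme.Modules.Hom.comp_app, Iso.hom_inv_id,
    Scheme.Modules.Hom.id_app]
  rfl

/-- **Coordinates of `θ(y)` in the frame `e ≫ θ|` transported along an isomorphism `θ : M ≅ N` are the coordinates of `y` in `e`.**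
[cite: GortzWedhorn2020, Prop. 11.15 and Rem. 11.16 (p. 298)] -/
theorem coord_trans_overFunctor_mapIso_hom_app {Y : Scheme.{u}} {M N : Y.Modules} (θ : M ≅ N) {W V : Y.Opens} {I : Type u}
    (e : SheafOfModules.free I ≅ M.over W) (k : V ⟶ W) (y : Γ(M, V)) (i : I) :
    coord (e ≪≫ (SheafOfModules.overFunctor _ W).mapIso θ) k (θ.hom.app V y) i = coord e k y i := by
  rw [GeneratingSections.coord_trans_overFunctor_mapIso, appLE_mapIso_inv_app]

/-- **(E2) COORDINATE FORM of «evaluation commutes with base change»**: for a rank-one frame `g : 𝒪^{I'} ≅ (x^*L)|_{U'}`, in the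
frame `η_h(g) ≫ θ|` of `x'^*pr^*L` over `h⁻¹U'` (★ `pullbackFrame`) the `i₀`-th coordinate of `ev_{x'}(β(η_h b))` over `h⁻¹V` is `h♯` of
the `i₀`-th coordinate of `ev_x(b)` in `g` — the entries of the (G1) matrix of the BASE-CHANGED family are the pulled-back entries.
[cite: MumfordFogartyKirwan1994, Ch. 3 §1 Proposition 3.1 (p. 68)] [cite: Hartshorne1977, II §5 (p. 110)] -/
theorem coord_evalAtSection_pushforwardBaseChangeHom_unitSection {U' : T.Opens} {I' : Type u} [Fintype I']
    (g : SheafOfModules.free I' ≅ ((Scheme.Modules.pullback x).obj L).over U') (i₀ : I') {V : T.Opens} (k' : V ⟶ U')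
    (b : Γ((Scheme.Modules.pushforward f).obj L, V)) :
    coord (pullbackFrame h g ≪≫ (SheafOfModules.overFunctor _ (h ⁻¹ᵁ U')).mapIso
        ((Scheme.Modules.pullbackComp h x).app L ≪≫ (Scheme.Modules.pullbackCongr hxx'.symm).app L ≪≫
            ((Scheme.Modules.pullbackComp x' pr).app L).symm :
          (Scheme.Modules.pullback h).obj ((Scheme.Modules.pullback x).obj L) ≅
            (Scheme.Modules.pullback x').obj ((Scheme.Modules.pullback pr).obj L)))
      ((Opens.map h.base).map k')
      ((evalAtSection f' x' hx' ((Scheme.Modules.pullback pr).obj L)).app (h ⁻¹ᵁ V)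
        ((pushforwardBaseChangeHom w L).app (h ⁻¹ᵁ V)
          (unitSection h ((Scheme.Modules.pushforward f).obj L) V b)))
      i₀ =
      h.app V (coord g k' ((evalAtSection f x hx L).app V b) i₀) := by
  rw [evalAtSection_app_pushforwardBaseChangeHom_unitSection w x hx x' hx' hxx' L V b, coord_trans_overFunctor_mapIso_hom_app,
    coord_pullbackFrame_unitSection]

end SquareBaseChange

section Naturality

variable {X T : Scheme.{u}} (f : X ⟶ T) (x : T ⟶ X) (hx : x ≫ f = 𝟙 T) {L₁ L₂ : X.Modules}

/-- **(N1) `ev_x` IS NATURAL IN THE MODULE**: for `φ : L₁ → L₂`, `f_*φ ≫ ev_x = ev_x ≫ x^*φ` (on sections: `η_x(φ b) = (x^*φ)(η_x b)`,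
★ `pullback_map_app_unitSection`). [cite: Hartshorne1977, II §5 (p. 110)] -/
theorem pushforward_map_comp_evalAtSection (φ : L₁ ⟶ L₂) :
    (Scheme.Modules.pushforward f).map φ ≫ evalAtSection f x hx L₂ =
      evalAtSection f x hx L₁ ≫ (Scheme.Modules.pullback x).map φ := by
  refine Scheme.Modules.hom_ext _ _ fun V => ?_
  rw [Scheme.Modules.Hom.comp_app, Scheme.Modules.Hom.comp_app]
  refine AddCommGrpCat.ext fun (b : Γ((Scheme.Modules.pushforward f).obj L₁, V)) => ?_
  change (evalAtSection f x hx L₂).app V (((Scheme.Modules.pushforward f).map φ).app V b) =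
    ((Scheme.Modules.pullback x).map φ).app V ((evalAtSection f x hx L₁).app V b)
  rw [Scheme.Modules.pushforward_map_app]
  erw [evalAtSection_app f x hx L₂ V (φ.app (f ⁻¹ᵁ V) b), evalAtSection_app f x hx L₁ V b]
  rw [app_presheaf_map, pullback_map_app_unitSection]

/-- (N1) on sections: `ev_x(φ(b)) = (x^*φ)(ev_x(b))`. [cite: Hartshorne1977, II §5 (p. 110)] -/
theorem evalAtSection_app_pushforward_map (φ : L₁ ⟶ L₂) (V : T.Opens) (b : Γ((Scheme.Modules.pushforward f).obj L₁, V)) :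
    (evalAtSection f x hx L₂).app V (((Scheme.Modules.pushforward f).map φ).app V b) =
      ((Scheme.Modules.pullback x).map φ).app V ((evalAtSection f x hx L₁).app V b) := by
  rw [← CategoryTheory.comp_apply, ← Scheme.Modules.Hom.comp_app, pushforward_map_comp_evalAtSection f x hx φ,
    Scheme.Modules.Hom.comp_app, CategoryTheory.comp_apply]

/-- **(N2) COORDINATE FORM of the naturality along an isomorphism `φ : L₁ ≅ L₂`**: in the frame `g ≫ x^*φ|` of `x^*L₂` transported from
a frame `g` of `x^*L₁` over `U'`, the coordinates of `ev_x(φ b)` are the coordinates of `ev_x(b)` in `g`.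
[cite: Hartshorne1977, II §5 (p. 110)] [cite: GortzWedhorn2020, Prop. 11.15 and Rem. 11.16 (p. 298)] -/
theorem coord_evalAtSection_transport (φ : L₁ ≅ L₂) {U' : T.Opens} {I' : Type u}
    (g : SheafOfModules.free I' ≅ ((Scheme.Modules.pullback x).obj L₁).over U') (i₀ : I') {V : T.Opens} (k' : V ⟶ U')
    (b : Γ((Scheme.Modules.pushforward f).obj L₁, V)) :
    coord (g ≪≫ (SheafOfModules.overFunctor _ U').mapIso ((Scheme.Modules.pullback x).mapIso φ)) k'
        ((evalAtSection f x hx L₂).app V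
          (((Scheme.Modules.pushforward f).map φ.hom).app V b)) i₀ =
      coord g k' ((evalAtSection f x hx L₁).app V b) i₀ := by
  rw [evalAtSection_app_pushforward_map f x hx φ.hom V b, GeneratingSections.coord_trans_overFunctor_mapIso]
  congr 1
  rw [← Functor.mapIso_hom]
  exact appLE_mapIso_inv_app ((Scheme.Modules.pullback x).mapIso φ) k' _

end Naturality

section Transport

variable {X T X' T' : Scheme.{u}} {f : X ⟶ T} {h : T' ⟶ T} {pr : X' ⟶ X} {f' : X' ⟶ T'} (w : pr ≫ f = f' ≫ h)
  (L : X.Modules) {M : X'.Modules} (φ : (Scheme.Modules.pullback pr).obj L ≅ M) [IsIso (pushforwardBaseChangeHom w L)]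
  {n : ℕ} (x : Fin n → (T ⟶ X)) (hx : ∀ j, x j ≫ f = 𝟙 T) (x' : Fin n → (T' ⟶ X')) (hx' : ∀ j, x' j ≫ f' = 𝟙 T')
  (hxx' : ∀ j, x' j ≫ pr = h ≫ x j)
  {U V : T.Opens} {I : Type u} [Fintype I]
  (eU : SheafOfModules.free I ≅ ((Scheme.Modules.pushforward f).obj L).over U) (ε : I ≃ Fin n) (k : V ⟶ U)
  {U' : Fin n → T.Opens} {I' : Fin n → Type u} [∀ j, Fintype (I' j)]
  (g : ∀ j, SheafOfModules.free (I' j) ≅ ((Scheme.Modules.pullback (x j)).obj L).over (U' j)) (ι : ∀ j, I' j)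
  (k' : ∀ j, V ⟶ U' j) {Ue : T'.Opens} (eqU : Ue ⟶ h ⁻¹ᵁ U) (kU : h ⁻¹ᵁ V ⟶ Ue)

/-- Basis sections of a frame moved across an isomorphism of modules are the images of the basis sections. [folklore] -/
private theorem basisSection_trans_mapIso' {Y : Scheme.{u}} {E E' : Y.Modules} {W : Y.Opens} {J : Type u}
    (e : SheafOfModules.free J ≅ E.over W) (ψ : E ≅ E') (i : J) :
    basisSection (e ≪≫ (SheafOfModules.overFunctor _ W).mapIso ψ) i = ψ.hom.app W (basisSection e i) := by
  rw [basisSection, basisSection, Iso.trans_hom, SheafOfModules.freeHomEquiv_comp_apply,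
    overSectionsEquiv_sectionsMap', Functor.mapIso_hom, appLE_over_map]

/-- **BASE CHANGE OF THE EVALUATION MATRIX WITH TRANSPORTED FRAMES**: the (G1) matrix of the base-changed family `ev_{x'_j} : f'_*M → x'_j{}^*M`
(`φ : pr^*L ≅ M`) in the frame `η_h(e_U)| ≫ (β ≫ f'_*φ)|` of `f'_*M` and the frames `η_h(g_j) ≫ (θ_j ≫ x'_j{}^*φ)|` of the `x'_j{}^*M` IS `h♯` OF
THE MATRIX of `ev_{x_j}` in `(e_U, g_j)` — entrywise (E2) + (N2). [cite: MumfordFogartyKirwan1994, Ch. 3 §1 Proposition 3.1 (p. 68)]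
[cite: Hartshorne1977, III Prop. 9.3 (Remark 9.3.1)] -/
theorem evalMatrix_baseChange_transport :
    evalMatrix (fun j => evalAtSection f' (x' j) (hx' j) M)
        (SheafOfModules.restrictTrivialisation (R := T'.ringCatSheaf) eqU (pullbackFrame h eU) ≪≫ (SheafOfModules.overFunctor _ Ue).mapIso
          (asIso (pushforwardBaseChangeHom w L) ≪≫ (Scheme.Modules.pushforward f').mapIso φ)) ε kU
        (fun j => pullbackFrame h (g j) ≪≫ (SheafOfModules.overFunctor _ (h ⁻¹ᵁ U' j)).mapIso
          (((Scheme.Modules.pullbackComp h (x j)).app L ≪≫ (Scheme.Modules.pullbackCongr (hxx' j).symm).app L ≪≫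
              ((Scheme.Modules.pullbackComp (x' j) pr).app L).symm : (Scheme.Modules.pullback h).obj ((Scheme.Modules.pullback (x j)).obj L) ≅
                (Scheme.Modules.pullback (x' j)).obj ((Scheme.Modules.pullback pr).obj L)) ≪≫ (Scheme.Modules.pullback (x' j)).mapIso φ))
        ι (fun j => (Opens.map h.base).map (k' j)) =
      (evalMatrix (fun j => evalAtSection f (x j) (hx j) L) eU ε k g ι k').map (h.app V).hom := by
  ext a j
  rw [Matrix.map_apply, evalMatrix_apply, evalMatrix_apply, basisSection_trans_mapIso', basisSection_restrictTrivialisation,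
    basisSection_pullbackFrame, Iso.trans_hom, Scheme.Modules.Hom.comp_app, CategoryTheory.comp_apply, asIso_hom,
    Functor.mapIso_hom, ← app_presheaf_map, ← app_presheaf_map, presheaf_map_map,
    presheaf_map_congr _ (kU ≫ eqU) ((Opens.map h.base).map k), ← unitSection_map, Functor.mapIso_trans,
    ← Iso.trans_assoc, coord_evalAtSection_transport f' (x' j) (hx' j) φ,
    coord_evalAtSection_pushforwardBaseChangeHom_unitSection w (x j) (hx j) (x' j) (hx' j) (hxx' j) L (g j) (ι j) (k' j)]

/-- **BASE CHANGE OF THE EVALUATION DETERMINANT WITH TRANSPORTED FRAMES: `det A' = h♯(det A)`.**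
[cite: MumfordFogartyKirwan1994, Ch. 3 §1 Proposition 3.1 (p. 68)] [cite: Hartshorne1977, III Prop. 9.3 (Remark 9.3.1)] -/
theorem evalDet_baseChange_transport :
    evalDet (fun j => evalAtSection f' (x' j) (hx' j) M)
        (SheafOfModules.restrictTrivialisation (R := T'.ringCatSheaf) eqU (pullbackFrame h eU) ≪≫ (SheafOfModules.overFunctor _ Ue).mapIso
          (asIso (pushforwardBaseChangeHom w L) ≪≫ (Scheme.Modules.pushforward f').mapIso φ)) ε kU
        (fun j => pullbackFrame h (g j) ≪≫ (SheafOfModules.overFunctor _ (h ⁻¹ᵁ U' j)).mapIso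
          (((Scheme.Modules.pullbackComp h (x j)).app L ≪≫ (Scheme.Modules.pullbackCongr (hxx' j).symm).app L ≪≫
              ((Scheme.Modules.pullbackComp (x' j) pr).app L).symm : (Scheme.Modules.pullback h).obj ((Scheme.Modules.pullback (x j)).obj L) ≅
                (Scheme.Modules.pullback (x' j)).obj ((Scheme.Modules.pullback pr).obj L)) ≪≫ (Scheme.Modules.pullback (x' j)).mapIso φ))
        ι (fun j => (Opens.map h.base).map (k' j)) =
      h.app V (evalDet (fun j => evalAtSection f (x j) (hx j) L) eU ε k g ι k') := by
  rw [evalDet_eq_det, evalDet_eq_det, evalMatrix_baseChange_transport w L φ x hx x' hx' hxx']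
  change _ = (h.app V).hom _
  rw [RingHom.map_det]
  rfl

/-- … hence the non-vanishing locus is the preimage: `T'_{det A'} = h⁻¹(T_{det A})`. [cite: MumfordFogartyKirwan1994, Ch. 3 §1 Proposition 3.1 (p. 68)] -/
theorem basicOpen_evalDet_baseChange_transport :
    T'.basicOpen (evalDet (fun j => evalAtSection f' (x' j) (hx' j) M)
        (SheafOfModules.restrictTrivialisation (R := T'.ringCatSheaf) eqU (pullbackFrame h eU) ≪≫ (SheafOfModules.overFunctor _ Ue).mapIso
          (asIso (pushforwardBaseChangeHom w L) ≪≫ (Scheme.Modules.pushforward f').mapIso φ)) ε kU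
        (fun j => pullbackFrame h (g j) ≪≫ (SheafOfModules.overFunctor _ (h ⁻¹ᵁ U' j)).mapIso
          (((Scheme.Modules.pullbackComp h (x j)).app L ≪≫ (Scheme.Modules.pullbackCongr (hxx' j).symm).app L ≪≫
              ((Scheme.Modules.pullbackComp (x' j) pr).app L).symm : (Scheme.Modules.pullback h).obj ((Scheme.Modules.pullback (x j)).obj L) ≅
                (Scheme.Modules.pullback (x' j)).obj ((Scheme.Modules.pullback pr).obj L)) ≪≫ (Scheme.Modules.pullback (x' j)).mapIso φ))
        ι (fun j => (Opens.map h.base).map (k' j))) =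
      h ⁻¹ᵁ T.basicOpen (evalDet (fun j => evalAtSection f (x j) (hx j) L) eU ε k g ι k') := by
  rw [evalDet_baseChange_transport w L φ x hx x' hx' hxx', Scheme.preimage_basicOpen]

end Transport

end Literature.AlgebraicGeometry.Modules

end
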